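import Mathlib
import Summits.NavierStokesRegularity.FluidComputer.AbcLatticeReality

/-!
# Class-II layer of the skew-cut X0 chain: DEFINITIONS
(instab4 g6 — implementation 2 of the skew-cut X0 certifier, cell `ns-blowup`, 2026-08-26)

HONEST FRAMING (human ruling D-0035): nothing here is a claim about Navier–Stokes blow-up.
WHAT THIS IS NOT: not NS evidence. MODEL lane — vocabulary only. These definitions give NAMES to
the objects that the accepted files of the X0 chain (`AbcLatticeEigenSynthesis`, `AbcLatticePairing*`,
`AbcLatticeTailCoercivity`, `AbcLatticeReality`, `AbcLatticeLocality` (instab4 g5);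
`AbcLatticeSymmetry*` (instab3 g4)) manipulate as INLINE terms, and set up the class-II layer of
`HOME/instab4/KERNEL-CHAIN.md` §2 (A3)/(A5) in CARTESIAN family coordinates `c : ℤ³ → ℂ³`:

* §1 `crossForm A B C c k = Σ_{s ∈ {±e_j}} Û(s) × (i(k−s) × c(k−s) − c(k−s))` (the certifiers' first-
  order symbol, `Û = Torus.abcCoeff A B C`) and the section operator
  `secOp R x c k = (x + |k|²/R) c(k) − Π_k (crossForm 1 1 1 c k)` (`= ((x − L_R) c)(k)`, certifier
  units, `L_R = −(1/R)|k|² + Π X`; METHOD-I4 §1 / INSTAB3-METHOD §1).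
* §2 The two generators of the 24-element symmetry group of the ABC flow `A = B = C` acting on
  families, `rotR` (`r : x ↦ (x₁, x₂, x₀)`) and `rotS` (`s : x ↦ (x₀ + ¼, x₂ + ¾, −x₁ + ¼)`), written
  EXACTLY as the lambda terms of `AbcLatticeSymmetryGenerators.linOp_abcFlow_classII_invariant`
  (instab3 g4), and SYMMETRY CLASS II `IsClassII c := rotR c = c ∧ rotS c = −c` (the sign character).
* §3 Signed-permutation orbits of lattice frequencies (`sgnAct`, `sgnOrbit`; at most 48 points, one
  Euclidean sphere, one sup-norm shell; invariant under `r`, `s` and `k ↦ −k`), sup-norm cubes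
  `cube n = {‖k‖_∞ ≤ n}`, `supNorm`.
* §4 For a finite frequency set `S`: vectors indexed by `S × Fin 3` ↔ families (`extend`, `restrictTo`)
  and the REAL space `realSpace S` of vectors whose family is transversal (`k · c(k) = 0`), class II
  and conjugate-symmetric (`Torus.IsConjSymm`, `c(−k) = conj c(k)`) — a real subspace of the complex
  Euclidean space `ℂ^{S × 3}`, hence a finite-dimensional real inner product space
  (`⟪x, y⟫_ℝ = Re ⟪x, y⟫_ℂ`).
* §5 The ORBIT-ADAPTED BASIS: the type `Orbit` of orbits of non-zero frequencies, the dimension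
  `odim O = finrank_ℝ (realSpace O)`, an (arbitrary, `stdOrthonormalBasis`) real orthonormal basis
  `orbitBasis O` of `realSpace O`, the index type `Idx = Σ O, Fin (odim O)` and the basis families
  `bfam i : ℤ³ → ℂ³` (supported on one orbit, transversal, class II, conjugate-symmetric, orthonormal);
  orbit data `onormSq`, `osupNorm`, `toOrbit`; the finite index sets `cubeIdx n` (orbits inside the
  cube `n` = the certificates' Galerkin SECTIONS) and `nbrIdx i` (orbits meeting the six-neighbour
  set of the orbit of `i` = the BAND of the first-order matrix).
* §6 The real first-order matrix `amat i j = Re Σ_{k} ⟪bfam i k, Π_k crossForm(bfam j)(k)⟫` and the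
  head compression `headOp R x S : realSpace S →ₗ[ℝ] realSpace S` (orthogonal projection of
  `restrictTo S ∘ secOp R x ∘ extend S`; for orbit-closed `S` the projection is the identity — proved
  in the sequel), whose `LinearMap.det` carries the BASIS-FREE head-sign hypothesis of the end-to-end
  theorem.

No theorems beyond the closure proofs the `Submodule` structure requires. Sequel files
(`AbcClassIIOrbits`, `AbcClassIIIndex`, `AbcClassIISections`, `AbcClassIIX0`) prove the properties.
Mathlib + Literature + `AbcLatticeReality` (linearity of `crossForm`) only.
-/

noncomputable section

open scoped BigOperators ComplexConjugate InnerProductSpace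
open Finset

namespace Summit.NavierStokesRegularity.FluidComputer.AbcClassII

open Literature.Analysis.FunctionSpaces Literature.Analysis.FunctionSpaces.Torus
open Literature.Analysis.FunctionSpaces.EuclideanSpace
open Literature.Analysis.FluidPDE Literature.Analysis.FluidPDE.SteadyLattice

/-! ### §1 The certifiers' first-order symbol and section operator -/

/-- Cartesian coefficient families on the Fourier lattice `ℤ³` with values in `ℂ³`. -/
abbrev Fam : Type := (Fin 3 → ℤ) → EuclideanSpace ℂ (Fin 3)

/-- **The certifiers' first-order symbol** `X c(k) = Σ_{s ∈ {±e_j}} Û(s) × (i(k−s) × c(k−s) − c(k−s))`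
(`Û = Torus.abcCoeff A B C`; METHOD-I4 §1, INSTAB3-METHOD §1) — the inline term of
`AbcLatticeEigenSynthesis.isLinNSEigenvalue_abcFlow_of_certifier_eigen` and of all `AbcLattice*` files. -/
def crossForm (A B C : ℝ) (c : Fam) (k : Fin 3 → ℤ) : EuclideanSpace ℂ (Fin 3) :=
  ∑ s ∈ Torus.abcFreq, (WithLp.toLp 2 (crossProduct (WithLp.ofLp (Torus.abcCoeff A B C s))
    (Complex.I • crossProduct (fun j => (((k - s) j : ℤ) : ℂ)) (WithLp.ofLp (c (k - s))) -
      WithLp.ofLp (c (k - s)))) : EuclideanSpace ℂ (Fin 3))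

/-- **The section operator** `((x − L_R) c)(k) = (x + |k|²/R) c(k) − Π_k X c(k)` of the ABC flow
`A = B = C = 1` in certifier units (`L_R = −(1/R)|k|² + Π X`; the inline term of
`AbcLatticeReality.certifierOp_conj`, `AbcLatticeTailCoercivity.tail_coercive_sum`). -/
def secOp (R x : ℝ) (c : Fam) : Fam := fun k =>
  ((x + freqNormSq k / R : ℝ) : ℂ) • c k - Torus.lerayCoeff k (crossForm 1 1 1 c k)

/-! ### §2 The two generators of the symmetry group and class II -/

/-- **Generator `r`** (`x ↦ (x₁, x₂, x₀)`, linear part the cyclic coordinate permutation, no shift, no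
signs): `(rotR c)(m)_p = c(M_rᵀ m)_{p+1}`, `(M_rᵀ m)_i = m_{i+2}` — literally the term of hypothesis
`hr` of `AbcLatticeSymmetryGenerators.linOp_abcFlow_classII_invariant` with its unit factors
`θ_r = 1`, `σ_r = 1` removed. -/
def rotR (c : Fam) : Fam := fun m =>
  WithLp.toLp 2 fun p : Fin 3 => c (fun i : Fin 3 => m ((finRotate 3).symm i)) ((finRotate 3) p)

/-- **Generator `s`** (`x ↦ (x₀ + ¼, x₂ + ¾, −x₁ + ¼)`): `(rotS c)(m)_p = θ_s(m) σ_s(p) c(M_sᵀ m)_{π p}`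
with `θ_s(m) = (−i)^{m₀ + 3m₁ + m₂}`, `σ_s = (1, 1, −1)`, `π = (1 2)`, `M_sᵀ m = (m₀, −m₂, m₁)` —
literally the term of hypothesis `hs` of `AbcLatticeSymmetryGenerators.linOp_abcFlow_classII_invariant`. -/
def rotS (c : Fam) : Fam := fun m =>
  WithLp.toLp 2 fun p : Fin 3 => (-Complex.I) ^ (m 0 + 3 * m 1 + m 2) *
    ((((![1, 1, -1] : Fin 3 → ℤ) p : ℤ) : ℂ) *
      c (fun i : Fin 3 => (![1, 1, -1] : Fin 3 → ℤ) ((Equiv.swap (1 : Fin 3) 2).symm i) *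
        m ((Equiv.swap (1 : Fin 3) 2).symm i)) ((Equiv.swap (1 : Fin 3) 2) p))

/-- **Symmetry class II** (the sign character of the 24-element group `Γ ≅ O` of the ABC flow
`A = B = C`, INSTAB3-METHOD §1 «II (sign)»; `AbcLatticeSymmetryGenerators`: `χ_II(r) = +1`,
`χ_II(s) = −1`, `⟨r, s⟩ = Γ`): `ρ_r c = c` and `ρ_s c = −c`. -/
def IsClassII (c : Fam) : Prop := rotR c = c ∧ rotS c = -c

/-! ### §3 Signed-permutation orbits, cubes -/

/-- The action of a signed coordinate permutation `g = (π, ε)` on a lattice frequency: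
`(g • k)_i = ±k_{π i}` (`+` iff `ε i`). -/
def sgnAct (g : Equiv.Perm (Fin 3) × (Fin 3 → Bool)) (k : Fin 3 → ℤ) : Fin 3 → ℤ :=
  fun i => (if g.2 i then 1 else -1) * k (g.1 i)

/-- **The signed-permutation orbit** of a frequency `k`: all `(±k_{π 0}, ±k_{π 1}, ±k_{π 2})` (at most
`48` points; contains `k`, `−k`, `M_rᵀ k`, `M_sᵀ k`; lies on the sphere `|m|² = |k|²` and the sup-norm
shell `‖m‖_∞ = ‖k‖_∞`). The supports of the basis families. -/
def sgnOrbit (k : Fin 3 → ℤ) : Finset (Fin 3 → ℤ) :=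
  (Finset.univ : Finset (Equiv.Perm (Fin 3) × (Fin 3 → Bool))).image fun g => sgnAct g k

/-- The sup norm `‖k‖_∞ = max_i |k_i|` of a lattice frequency, as a natural number. -/
def supNorm (k : Fin 3 → ℤ) : ℕ := Finset.univ.sup fun i => (k i).natAbs

/-- The sup-norm cube `{k : |k_i| ≤ n ∀ i}` of the lattice (the index set of the certificates'
Galerkin section of level `n`, SKEWCUT-CERT (F3)). -/
def cube (n : ℕ) : Finset (Fin 3 → ℤ) :=
  Fintype.piFinset fun _ : Fin 3 => Finset.Icc (-(n : ℤ)) n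

/-! ### §4 Vectors on a finite frequency set and the real class-II space -/

/-- Extension by zero: a vector indexed by `S × Fin 3` as a family on `ℤ³` supported in `S`. -/
def extend (S : Finset (Fin 3 → ℤ)) (x : EuclideanSpace ℂ (↥S × Fin 3)) : Fam :=
  fun k => WithLp.toLp 2 fun p : Fin 3 => if h : k ∈ S then x (⟨k, h⟩, p) else 0

/-- Restriction of a family to the frequency set `S`, as a vector indexed by `S × Fin 3`. -/
def restrictTo (S : Finset (Fin 3 → ℤ)) (c : Fam) : EuclideanSpace ℂ (↥S × Fin 3) :=
  WithLp.toLp 2 fun kp : ↥S × Fin 3 => c kp.1.1 kp.2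

/-- `extend` is additive. -/
theorem extend_add (S : Finset (Fin 3 → ℤ)) (x y : EuclideanSpace ℂ (↥S × Fin 3)) :
    extend S (x + y) = extend S x + extend S y := by
  funext k; ext p
  by_cases h : k ∈ S <;> simp [extend, h]

/-- `extend` commutes with complex scalars. -/
theorem extend_smul (S : Finset (Fin 3 → ℤ)) (a : ℂ) (x : EuclideanSpace ℂ (↥S × Fin 3)) :
    extend S (a • x) = a • extend S x := by
  funext k; ext p
  by_cases h : k ∈ S <;> simp [extend, h]

/-- `extend 0 = 0`. -/
theorem extend_zero (S : Finset (Fin 3 → ℤ)) : extend S (0 : EuclideanSpace ℂ (↥S × Fin 3)) = 0 := by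
  funext k; ext p
  by_cases h : k ∈ S <;> simp [extend, h]

/-- `rotR` is additive. -/
theorem rotR_add (c d : Fam) : rotR (c + d) = rotR c + rotR d := by
  funext m; ext p; simp [rotR]

/-- `rotR` commutes with complex scalars. -/
theorem rotR_smul (a : ℂ) (c : Fam) : rotR (a • c) = a • rotR c := by
  funext m; ext p; simp [rotR]

/-- `rotS` is additive. -/
theorem rotS_add (c d : Fam) : rotS (c + d) = rotS c + rotS d := by
  funext m; ext p; simp [rotS]; ring

/-- `rotS` commutes with complex scalars. -/
theorem rotS_smul (a : ℂ) (c : Fam) : rotS (a • c) = a • rotS c := by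
  funext m; ext p; simp [rotS]; ring

/-- Class II is a complex-linear condition: closed under addition. -/
theorem IsClassII.add {c d : Fam} (hc : IsClassII c) (hd : IsClassII d) : IsClassII (c + d) := by
  refine ⟨?_, ?_⟩
  · rw [rotR_add, hc.1, hd.1]
  · rw [rotS_add, hc.2, hd.2, neg_add]

/-- Class II is closed under complex scalars. -/
theorem IsClassII.smul {c : Fam} (hc : IsClassII c) (a : ℂ) : IsClassII (a • c) := by
  refine ⟨?_, ?_⟩
  · rw [rotR_smul, hc.1]
  · rw [rotS_smul, hc.2, smul_neg]

/-- The zero family is class II. -/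
theorem isClassII_zero : IsClassII (0 : Fam) := by
  refine ⟨?_, ?_⟩
  · funext m; ext p; simp [rotR]
  · funext m; ext p; simp [rotS]

/-- **The real class-II space on a finite frequency set `S`**: vectors `x ∈ ℂ^{S × 3}` whose family
`extend S x` is transversal (`k · c(k) = 0` for all `k`), class II, and conjugate-symmetric
(`c(−k) = conj c(k)`, `Torus.IsConjSymm`). A REAL subspace (conjugate symmetry is only real-linear) of
the complex Euclidean space, which is a real inner product space with `⟪x, y⟫_ℝ = Re ⟪x, y⟫_ℂ`; for `S`
an orbit (or a union of orbits) these are the real Galerkin spaces of the certifiers (class-II,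
`cos / sin` bases: INSTAB3-METHOD §2(a), METHOD-I4 §1). -/
def realSpace (S : Finset (Fin 3 → ℤ)) : Submodule ℝ (EuclideanSpace ℂ (↥S × Fin 3)) where
  carrier := {x | (∀ k : Fin 3 → ℤ, ∑ j : Fin 3, ((k j : ℤ) : ℂ) * extend S x k j = 0) ∧
    IsClassII (extend S x) ∧ Torus.IsConjSymm (extend S x)}
  add_mem' := by
    rintro x y ⟨hxt, hxc, hxj⟩ ⟨hyt, hyc, hyj⟩
    refine ⟨fun k => ?_, ?_, ?_⟩
    · rw [extend_add]
      have h : ∑ j : Fin 3, ((k j : ℤ) : ℂ) * (extend S x + extend S y) k j =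
          ∑ j : Fin 3, ((k j : ℤ) : ℂ) * extend S x k j + ∑ j : Fin 3, ((k j : ℤ) : ℂ) * extend S y k j := by
        rw [← Finset.sum_add_distrib]
        refine Finset.sum_congr rfl fun j _ => ?_
        simp only [Pi.add_apply, PiLp.add_apply, mul_add]
      rw [h, hxt k, hyt k, add_zero]
    · rw [extend_add]; exact hxc.add hyc
    · rw [extend_add]; exact hxj.add hyj
  zero_mem' := by
    refine ⟨fun k => ?_, ?_, ?_⟩
    · rw [extend_zero]; simp
    · rw [extend_zero]; exact isClassII_zero
    · rw [extend_zero]; exact Torus.isConjSymm_zero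
  smul_mem' := by
    rintro a x ⟨hxt, hxc, hxj⟩
    have ha : (a • x : EuclideanSpace ℂ (↥S × Fin 3)) = ((a : ℂ) • x) := rfl
    refine ⟨fun k => ?_, ?_, ?_⟩
    · rw [ha, extend_smul]
      have h : ∑ j : Fin 3, ((k j : ℤ) : ℂ) * ((a : ℂ) • extend S x) k j =
          (a : ℂ) * ∑ j : Fin 3, ((k j : ℤ) : ℂ) * extend S x k j := by
        rw [Finset.mul_sum]
        refine Finset.sum_congr rfl fun j _ => ?_
        simp only [Pi.smul_apply, PiLp.smul_apply, smul_eq_mul]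
        ring
      rw [h, hxt k, mul_zero]
    · rw [ha, extend_smul]; exact hxc.smul _
    · rw [ha, extend_smul]
      intro k
      rw [Pi.smul_apply, Pi.smul_apply, hxj k, conjVec_smul, Complex.conj_ofReal]

/-! ### §5 Orbits as an index of the basis; the orbit-adapted real orthonormal basis -/

/-- The type of signed-permutation orbits of NON-ZERO lattice frequencies. -/
def Orbit : Type := {O : Finset (Fin 3 → ℤ) // ∃ k : Fin 3 → ℤ, k ≠ 0 ∧ sgnOrbit k = O}

/-- Orbits are finite sets of frequencies: equality is decidable. -/
instance : DecidableEq Orbit := Subtype.instDecidableEq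

/-- The orbit of a non-zero frequency, as an element of `Orbit`. -/
def toOrbit (k : Fin 3 → ℤ) (hk : k ≠ 0) : Orbit := ⟨sgnOrbit k, k, hk, rfl⟩

/-- A representative frequency of an orbit (a choice). -/
def Orbit.rep (O : Orbit) : Fin 3 → ℤ := O.2.choose

/-- `|k|²` on the orbit (the common Euclidean norm square of its points; the free LEVEL of the basis
families on `O` is `−onormSq O / R`). -/
def onormSq (O : Orbit) : ℝ := freqNormSq O.rep

/-- `‖k‖_∞` on the orbit (the common sup norm of its points = the sup-norm SHELL of the orbit). -/
def osupNorm (O : Orbit) : ℕ := supNorm O.rep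

/-- The real dimension `d_O` of the class-II real space on the orbit `O`. -/
abbrev odim (O : Orbit) : ℕ := Module.finrank ℝ (realSpace O.1)

/-- **The orbit-adapted real orthonormal basis**: an (arbitrary) orthonormal basis of the finite-
dimensional real inner product space `realSpace O`, indexed by `Fin (odim O)`. Only its EXISTENCE and
orthonormality are ever used; no formula for it is claimed (the certifiers' explicit orbit-pair /
Craya bases are other orthonormal bases of the same spaces). -/
def orbitBasis (O : Orbit) : OrthonormalBasis (Fin (odim O)) ℝ (realSpace O.1) :=
  stdOrthonormalBasis ℝ (realSpace O.1)

/-- **The index type of the class-II basis**: an orbit and a basis index on it. -/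
def Idx : Type := Σ O : Orbit, Fin (odim O)

/-- Equality of basis indices is decidable. -/
instance : DecidableEq Idx := Sigma.instDecidableEqSigma

/-- **The basis families** `bfam i : ℤ³ → ℂ³`: the family (extension by zero) of the `i.2`-th vector
of the orthonormal basis of `realSpace (orbit i.1)` — supported on one orbit, transversal, class II,
conjugate-symmetric; jointly a complex orthonormal basis of the class-II transversal families
(proved in the sequel). -/
def bfam (i : Idx) : Fam := extend i.1.1 ((orbitBasis i.1 i.2 : realSpace i.1.1) : EuclideanSpace ℂ _)

/-- The orbits inside the cube `n` (those of the non-zero frequencies of `cube n`). -/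
def cubeOrbits (n : ℕ) : Finset Orbit :=
  ((cube n).filter (fun k => k ≠ 0)).attach.image
    fun k => toOrbit k.1 (by have h := Finset.mem_filter.mp k.2; exact h.2)

/-- **The Galerkin SECTION index set of level `n`**: all basis indices whose orbit lies in `cube n`
(the `F n` of `SkewCutGalerkinFromSections`). -/
def cubeIdx (n : ℕ) : Finset Idx :=
  (cubeOrbits n).sigma fun O => (Finset.univ : Finset (Fin (odim O)))

/-- The orbits meeting the six-neighbour set `O + {±e_j}` of an orbit `O` (non-zero points only). -/
def nbrOrbits (O : Orbit) : Finset Orbit :=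
  (((O.1 ×ˢ Torus.abcFreq).image fun ks => ks.1 - ks.2).filter (fun k => k ≠ 0)).attach.image
    fun k => toOrbit k.1 (by have h := Finset.mem_filter.mp k.2; exact h.2)

/-- **The BAND of the first-order matrix**: all basis indices on orbits meeting the six-neighbour set
of the orbit of `i` (the `nbr i` of `SkewCutGalerkinFromSections`; outside it the matrix vanishes by
`AbcLatticeLocality`). -/
def nbrIdx (i : Idx) : Finset Idx :=
  (nbrOrbits i.1).sigma fun O => (Finset.univ : Finset (Fin (odim O)))

/-! ### §6 The real first-order matrix and the head compression -/

/-- **The real first-order matrix in the orbit-adapted basis**: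
`amat i j = Re Σ_{k ∈ orbit i} ⟪bfam i k, Π_k X(bfam j)(k)⟫` (the sum is real by conjugate symmetry —
sequel). The section matrix of `x − L_R` on `cubeIdx n` is `(x + onormSq/R) δ_ij − amat i j`. -/
def amat (i j : Idx) : ℝ :=
  (∑ k ∈ i.1.1, (inner ℂ (bfam i k) (Torus.lerayCoeff k (crossForm 1 1 1 (bfam j) k)) : ℂ)).re

/-- `crossForm` is additive in the family (`AbcLatticeReality.crossForm_add`). -/
theorem crossForm_add (A B C : ℝ) (c d : Fam) (k : Fin 3 → ℤ) :
    crossForm A B C (c + d) k = crossForm A B C c k + crossForm A B C d k :=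
  AbcLatticeReality.crossForm_add A B C c d k

/-- `crossForm` is homogeneous in the family (`AbcLatticeReality.crossForm_smul`). -/
theorem crossForm_smul (A B C : ℝ) (a : ℂ) (c : Fam) (k : Fin 3 → ℤ) :
    crossForm A B C (a • c) k = a • crossForm A B C c k :=
  AbcLatticeReality.crossForm_smul A B C a c k

/-- The section operator is additive. -/
theorem secOp_add (R x : ℝ) (c d : Fam) : secOp R x (c + d) = secOp R x c + secOp R x d := by
  funext k
  simp only [secOp, Pi.add_apply, crossForm_add, lerayCoeff_add', smul_add]
  abel

/-- The section operator is homogeneous (complex scalars). -/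
theorem secOp_smul (R x : ℝ) (a : ℂ) (c : Fam) : secOp R x (a • c) = a • secOp R x c := by
  funext k
  simp only [secOp, Pi.smul_apply, crossForm_smul, lerayCoeff_smul', smul_sub, smul_smul, mul_comm a]

/-- `restrictTo` is additive. -/
theorem restrictTo_add (S : Finset (Fin 3 → ℤ)) (c d : Fam) :
    restrictTo S (c + d) = restrictTo S c + restrictTo S d := by
  ext kp; simp [restrictTo]

/-- `restrictTo` is homogeneous. -/
theorem restrictTo_smul (S : Finset (Fin 3 → ℤ)) (a : ℂ) (c : Fam) :
    restrictTo S (a • c) = a • restrictTo S c := by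
  ext kp; simp [restrictTo]

/-- The section operator between restriction and extension, `x ↦ (secOp R x (extend S x))|_S`, on the
real class-II space of `S`, as a real-linear map into the ambient complex Euclidean space. -/
def secLin (R x : ℝ) (S : Finset (Fin 3 → ℤ)) : realSpace S →ₗ[ℝ] EuclideanSpace ℂ (↥S × Fin 3) where
  toFun u := restrictTo S (secOp R x (extend S (u : EuclideanSpace ℂ (↥S × Fin 3))))
  map_add' u v := by
    rw [Submodule.coe_add, extend_add, secOp_add, restrictTo_add]
  map_smul' a u := by
    have ha : ((a • u : realSpace S) : EuclideanSpace ℂ (↥S × Fin 3)) =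
        (a : ℂ) • (u : EuclideanSpace ℂ (↥S × Fin 3)) := rfl
    rw [ha, extend_smul, secOp_smul, restrictTo_smul, RingHom.id_apply]
    rfl

/-- **The head compression** `headOp R x S = P_{realSpace S} ∘ (restrictTo S ∘ (x − L_R) ∘ extend S)`
as a real-linear endomorphism of the finite-dimensional real class-II space of `S` (`P` the
orthogonal projection; for orbit-closed `S`, e.g. `cube K` minus the origin, `P` acts as the identity
on the range — sequel). Its determinant `LinearMap.det (headOp R x S)` is the BASIS-FREE form of the
certificates' head determinant `det A⁽ᴷ⁾(x) = det (x·1 − L_K)` (any real orthonormal basis of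
`realSpace S` gives the same number). -/
def headOp (R x : ℝ) (S : Finset (Fin 3 → ℤ)) : realSpace S →ₗ[ℝ] realSpace S :=
  ((realSpace S).orthogonalProjectionOnto : EuclideanSpace ℂ (↥S × Fin 3) →L[ℝ] realSpace S).toLinearMap ∘ₗ
    secLin R x S

end Summit.NavierStokesRegularity.FluidComputer.AbcClassII

end
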